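import Literature.Analysis.FluidPDE.TaoEnstrophyLocalisationProofs
import Literature.Analysis.FluidPDE.ClassicalSolutionCalculus
import HarnessLib

/-!
# Calculus of the curl on `ℝ³`: linearity, Leibniz rule, integration by parts, `curl Δ = Δ curl`

Analysis/FluidPDE support file (serves the discharge of `Literature.Analysis.FluidPDE.tao2011_velocity_eq_of_memSobolevX`,
Tao 2011, Cor. 4.3 + Thm. 5.4 (iii), by the vorticity energy method for the difference of two
classical solutions: taking the curl of the momentum equation kills the pressure gradient, and the
enstrophy balance is obtained by pairing `∂ₜω = νΔω − curl G` with `φ ω` and integrating by parts).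

For `v : ℝ³ → ℝ³` the tree's `Fluid.curl v x` is `Fluid.curlCLM (Dv(x))` (`TaoEnstrophyLocalisation`,
`curl_eq_curlCLM`, definitional), so every statement below is a one-line consequence of the
corresponding `fderiv` rule:

* linearity at points of differentiability (`curl_add`, `curl_sub`, `curl_const_smul`, `curl_neg`,
  `curl_zero`) and the Leibniz rule `curl (φ v) = φ curl v + curlCLM (Dφ ⊗ v)` (`curl_smul`; the
  second term is `∇φ × v`, kept in the basis-free form `curlCLM ((fderiv ℝ φ x).smulRight (v x))`);
* regularity (`contDiff_curl`, `continuous_curl`, `hasCompactSupport_curl`);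
* **integration by parts** `∫ ⟪curl F, Ψ⟫ = ∫ ⟪F, curl Ψ⟫` for `F ∈ C¹`, `Ψ ∈ C¹_c`
  (`integral_inner_curl_eq_integral_inner_curl`: integrate the tree's pointwise identity
  `div (Ψ × F) = ⟪F, curl Ψ⟫ − ⟪Ψ, curl F⟫`, `Fluid.divergence_cross_holds` (`VectorCalculus`), the
  left side having zero integral by the tree's divergence theorem without boundary
  `Fluid.integral_divergence_eq_zero` (`WholeSpaceIBP`)), and its weighted form
  `∫ φ ⟪curl F, W⟫ = ∫ φ ⟪F, curl W⟫ + ∫ ⟪F, curlCLM (Dφ ⊗ W)⟫` (`integral_mul_inner_curl_eq`);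
* **`curl (Δv) = Δ (curl v)`** for `v ∈ C³` (`curl_laplacian`; both sides equal
  `Σᵢ curl (∂ᵢ∂ᵢ v)` by the tree's `Fluid.curl_fderiv_apply` and `Fluid.laplacian_eq_sum_fderiv_fderiv`).

## Mathlib / tree search

Mathlib (this pin) has no `curl` (only the algebraic `crossProduct` on `Fin 3 → R`); the tree has
the pointwise operator `Fluid.curl`, `Fluid.cross`/`Fluid.crossCLM` (`VectorCalculus`),
`Fluid.curlCLM`, `Fluid.fderiv_curl`, `Fluid.curl_fderiv_apply` (`TaoEnstrophyLocalisation(Proofs)`),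
and the discharged identities `Fluid.curl_gradient_eq_zero_holds`, `Fluid.divergence_cross_holds`
(`VectorCalculus`), `Fluid.divergence_curl_eq_zero_holds` (`VectorCalculusProofs`), on which the
integration by parts below is built; none of the statements below is in the tree
(`lean search 'curl_add|curl_smul|inner_curl|curl_laplacian'`).

## References

* A. J. Majda, A. L. Bertozzi, *Vorticity and Incompressible Flow* (CUP 2002), §1.1–1.2
  (vector identities), §2.1 eq. (2.5) (curl of the Navier–Stokes equations).
* L. C. Evans, *Partial Differential Equations*, 2nd ed. (2010), App. C.2 (Gauss–Green).
-/

noncomputable section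

open MeasureTheory Set Function Filter Topology InnerProductSpace
open scoped RealInnerProductSpace ENNReal NNReal Laplacian ContDiff

namespace Literature.Analysis.FluidPDE

/-- Local notation for physical space `ℝ³ = EuclideanSpace ℝ (Fin 3)`. -/
local notation "ℝ³" => EuclideanSpace ℝ (Fin 3)

/-! ### Linearity and the Leibniz rule at points of differentiability -/

/-- `curl (f + g) = curl f + curl g` at a point where both fields are differentiable
(Majda–Bertozzi, §1.1). [folklore] -/
theorem curl_add {f g : ℝ³ → ℝ³} {x : ℝ³} (hf : DifferentiableAt ℝ f x)
    (hg : DifferentiableAt ℝ g x) : curl (fun y => f y + g y) x = curl f x + curl g x := by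
  rw [curl_eq_curlCLM, curl_eq_curlCLM, curl_eq_curlCLM, ← map_add, fderiv_fun_add hf hg]

/-- `curl (f - g) = curl f - curl g` at a point where both fields are differentiable. [folklore] -/
theorem curl_sub {f g : ℝ³ → ℝ³} {x : ℝ³} (hf : DifferentiableAt ℝ f x)
    (hg : DifferentiableAt ℝ g x) : curl (fun y => f y - g y) x = curl f x - curl g x := by
  rw [curl_eq_curlCLM, curl_eq_curlCLM, curl_eq_curlCLM, ← map_sub, fderiv_fun_sub hf hg]

/-- `curl (c • f) = c • curl f` at a point where `f` is differentiable. [folklore] -/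
theorem curl_const_smul {f : ℝ³ → ℝ³} {x : ℝ³} (hf : DifferentiableAt ℝ f x) (c : ℝ) :
    curl (fun y => c • f y) x = c • curl f x := by
  rw [curl_eq_curlCLM, curl_eq_curlCLM, ← map_smul, fderiv_fun_const_smul hf c]

/-- `curl (-f) = -curl f` (everywhere: `fderiv` of `-f` is `-fderiv f`, junk values included). [folklore] -/
theorem curl_neg (f : ℝ³ → ℝ³) (x : ℝ³) : curl (fun y => -f y) x = -curl f x := by
  rw [curl_eq_curlCLM, curl_eq_curlCLM, ← map_neg, fderiv_fun_neg]

/-- The curl of the zero field vanishes. [folklore] -/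
@[simp]
theorem curl_zero (x : ℝ³) : curl (0 : ℝ³ → ℝ³) x = 0 := by
  rw [curl_eq_curlCLM]; simp

/-- The curl of the zero field vanishes (lambda form). [folklore] -/
@[simp]
theorem curl_fun_zero (x : ℝ³) : curl (fun _ => (0 : ℝ³)) x = 0 := by
  rw [curl_eq_curlCLM]; simp

/-- `curl f x = 0` where `Df(x) = 0` (in particular off the support of `f`). [folklore] -/
theorem curl_eq_zero_of_fderiv_eq_zero {f : ℝ³ → ℝ³} {x : ℝ³} (h : fderiv ℝ f x = 0) :
    curl f x = 0 := by
  rw [curl_eq_curlCLM, h, map_zero]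

/-- **Leibniz rule for the curl**: `curl (φ f)(x) = φ(x) curl f (x) + curlCLM (Dφ(x) ⊗ f(x))` for a
scalar `φ` and a field `f` differentiable at `x`; the second term is the familiar `∇φ × f`
(Majda–Bertozzi, §1.1, vector identities), written basis-free through the rank-one operator
`(fderiv ℝ φ x).smulRight (f x) : h ↦ (Dφ(x) h) f(x)`. [folklore] -/
theorem curl_smul {φ : ℝ³ → ℝ} {f : ℝ³ → ℝ³} {x : ℝ³} (hφ : DifferentiableAt ℝ φ x)
    (hf : DifferentiableAt ℝ f x) :
    curl (fun y => φ y • f y) x = φ x • curl f x + curlCLM ((fderiv ℝ φ x).smulRight (f x)) := by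
  rw [curl_eq_curlCLM, curl_eq_curlCLM, fderiv_fun_smul hφ hf, map_add, map_smul]

/-! ### Regularity -/

/-- `curl v ∈ Cⁿ` for `v ∈ Cⁿ⁺¹` (`curl = curlCLM ∘ D`). [folklore] -/
theorem contDiff_curl {v : ℝ³ → ℝ³} {n : ℕ∞} (hv : ContDiff ℝ (n + 1) v) :
    ContDiff ℝ n (curl v) := by
  rw [curl_eq_curlCLM_comp]
  exact curlCLM.contDiff.comp (hv.fderiv_right (m := n) le_rfl)

/-- The curl of a `C¹` field is continuous. [folklore] -/
theorem continuous_curl {v : ℝ³ → ℝ³} (hv : ContDiff ℝ 1 v) : Continuous (curl v) := by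
  rw [curl_eq_curlCLM_comp]
  exact curlCLM.continuous.comp (hv.continuous_fderiv one_ne_zero)

/-- The curl of a compactly supported field is compactly supported. [folklore] -/
theorem hasCompactSupport_curl {v : ℝ³ → ℝ³} (hc : HasCompactSupport v) :
    HasCompactSupport (curl v) := by
  rw [curl_eq_curlCLM_comp]
  exact (hc.fderiv (𝕜 := ℝ)).comp_left (map_zero _)

/-- The curl of `v` vanishes off the topological support of `v`. [folklore] -/
theorem curl_eq_zero_of_notMem_tsupport {v : ℝ³ → ℝ³} {x : ℝ³} (hx : x ∉ tsupport v) :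
    curl v x = 0 :=
  curl_eq_zero_of_fderiv_eq_zero (fderiv_of_notMem_tsupport ℝ hx)

/-! ### Integration by parts for the curl -/

/-- **Integration by parts for the curl** (the curl is formally self-adjoint): for `F ∈ C¹(ℝ³; ℝ³)`
and `Ψ ∈ C¹_c(ℝ³; ℝ³)`, `∫ ⟪curl F, Ψ⟫ = ∫ ⟪F, curl Ψ⟫`. Proof: by the tree's
`Fluid.divergence_cross_holds`, `div (Ψ × F) = ⟪F, curl Ψ⟫ − ⟪Ψ, curl F⟫` pointwise, and the
`C¹_c` field `Ψ × F` has `∫ div (Ψ × F) = 0` (`Fluid.integral_divergence_eq_zero`; Majda–Bertozzi,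
§1.1/§1.7 vector identities, and Evans, App. C.2, Gauss–Green without boundary). This is the step
"pair the vorticity equation with `ω`" of every enstrophy estimate. [folklore] -/
theorem integral_inner_curl_eq_integral_inner_curl {F Ψ : ℝ³ → ℝ³} (hF : ContDiff ℝ 1 F)
    (hΨ : ContDiff ℝ 1 Ψ) (hc : HasCompactSupport Ψ) :
    ∫ x, ⟪curl F x, Ψ x⟫ = ∫ x, ⟪F x, curl Ψ x⟫ := by
  have iL : Integrable (fun x => ⟪Ψ x, curl F x⟫) (volume : Measure ℝ³) :=
    integrable_inner_of_hasCompactSupport_left hΨ.continuous (continuous_curl hF) hc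
  have iR : Integrable (fun x => ⟪F x, curl Ψ x⟫) (volume : Measure ℝ³) :=
    integrable_inner_of_hasCompactSupport_right hF.continuous (continuous_curl hΨ)
      (hasCompactSupport_curl hc)
  -- the `C¹_c` field `Ψ × F` and its divergence
  have hX : ContDiff ℝ 1 fun y => cross (Ψ y) (F y) :=
    (crossCLM.contDiff.comp hΨ).clm_apply hF
  have hXc : HasCompactSupport fun y => cross (Ψ y) (F y) := by
    refine hc.mono fun x hx => ?_
    contrapose! hx
    simp only [mem_support, not_not] at hx
    simp [← crossCLM_apply, hx]
  have h0 := integral_divergence_eq_zero hX hXc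
  have hpt : ∀ x, VectorCalculus.divergence (fun y => cross (Ψ y) (F y)) x = ⟪F x, curl Ψ x⟫ - ⟪Ψ x, curl F x⟫ :=
    fun x => divergence_cross_holds Ψ F x (hΨ.differentiable one_ne_zero x)
      (hF.differentiable one_ne_zero x)
  simp_rw [hpt] at h0
  rw [integral_sub iR iL, sub_eq_zero] at h0
  rw [h0]
  exact integral_congr_ae (Eventually.of_forall fun x => real_inner_comm _ _)

/-- Weighted form used in energy estimates: for `F ∈ C¹`, `W ∈ C¹` and a `C¹_c` scalar weight `φ`,
`∫ φ ⟪curl F, W⟫ = ∫ φ ⟪F, curl W⟫ + ∫ ⟪F, curlCLM (Dφ ⊗ W)⟫` (integration by parts against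
`Ψ = φ W` and the Leibniz rule `curl_smul`; the last term is `∫ ⟪F, ∇φ × W⟫`). [folklore] -/
theorem integral_mul_inner_curl_eq {F W : ℝ³ → ℝ³} {φ : ℝ³ → ℝ} (hF : ContDiff ℝ 1 F)
    (hW : ContDiff ℝ 1 W) (hφ : ContDiff ℝ 1 φ) (hc : HasCompactSupport φ) :
    ∫ x, φ x * ⟪curl F x, W x⟫ =
      (∫ x, φ x * ⟪F x, curl W x⟫) +
        ∫ x, ⟪F x, curlCLM ((fderiv ℝ φ x).smulRight (W x))⟫ := by
  have hΨ : ContDiff ℝ 1 fun y => φ y • W y := hφ.smul hW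
  have hΨc : HasCompactSupport fun y => φ y • W y := hc.smul_right
  have h1 : ∫ x, φ x * ⟪curl F x, W x⟫ = ∫ x, ⟪curl F x, φ x • W x⟫ :=
    integral_congr_ae (Eventually.of_forall fun x => by simp only [real_inner_smul_right])
  rw [h1, integral_inner_curl_eq_integral_inner_curl hF hΨ hΨc]
  have hpt : ∀ x, ⟪F x, curl (fun y => φ y • W y) x⟫ =
      φ x * ⟪F x, curl W x⟫ + ⟪F x, curlCLM ((fderiv ℝ φ x).smulRight (W x))⟫ := fun x => by
    rw [curl_smul (hφ.differentiable one_ne_zero x) (hW.differentiable one_ne_zero x),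
      inner_add_right, real_inner_smul_right]
  simp_rw [hpt]
  have hcDφ : HasCompactSupport (fderiv ℝ φ) := hc.fderiv (𝕜 := ℝ)
  refine integral_add ?_ ?_
  · exact (hφ.continuous.mul (hF.continuous.inner (continuous_curl hW)))
      |>.integrable_of_hasCompactSupport hc.mul_right
  · have hsr : Continuous fun x => (fderiv ℝ φ x).smulRight (W x) :=
      ((hφ.fderiv_right (m := 0) (by norm_num)).smulRight (hW.of_le zero_le_one)).continuous
    refine (hF.continuous.inner (curlCLM.continuous.comp hsr))
      |>.integrable_of_hasCompactSupport (hcDφ.mono fun x hx => ?_)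
    contrapose! hx
    simp only [mem_support, not_not] at hx
    simp [hx]

/-! ### The curl commutes with the Laplacian -/

/-- **`curl (Δ v) = Δ (curl v)`** for `v ∈ C³(ℝ³; ℝ³)` (constant-coefficient operators commute;
Majda–Bertozzi, §2.1, the passage from (2.1) to the vorticity equation (2.5), where
`curl (νΔv) = νΔω`). Proof: with `Δ = Σᵢ ∂ᵢ∂ᵢ` (`Fluid.laplacian_eq_sum_fderiv_fderiv`) both sides
equal `Σᵢ curl (∂ᵢ∂ᵢ v)(x)`, using twice `curl (∂ₑ u) = ∂ₑ (curl u)` for `C²` fields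
(`Fluid.curl_fderiv_apply`, i.e. Schwarz's theorem). [folklore] -/
theorem curl_laplacian {v : ℝ³ → ℝ³} (hv : ContDiff ℝ 3 v) (x : ℝ³) :
    curl (Δ v) x = (Δ (curl v)) x := by
  set b := stdOrthonormalBasis ℝ ℝ³
  have hv2 : ContDiff ℝ 2 v := hv.of_le (by norm_cast)
  -- `∂ₑ v ∈ C²`, `∂ₑ'∂ₑ v ∈ C¹`, `curl v ∈ C²`
  have hd1 : ∀ e, ContDiff ℝ 2 fun y => fderiv ℝ v y e := fun e =>
    (hv.fderiv_right (m := 2) (by norm_cast)).clm_apply contDiff_const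
  have hd2 : ∀ e e', ContDiff ℝ 1 fun y => fderiv ℝ (fun z => fderiv ℝ v z e) y e' := fun e e' =>
    ((hd1 e).fderiv_right (m := 1) (by norm_cast)).clm_apply contDiff_const
  have hcurl2 : ContDiff ℝ 2 (curl v) := contDiff_curl (n := 2) (by exact_mod_cast hv)
  -- right-hand side
  have hR : (Δ (curl v)) x =
      ∑ i, curl (fun y => fderiv ℝ (fun z => fderiv ℝ v z (b i)) y (b i)) x := by
    rw [laplacian_eq_sum_fderiv_fderiv b hcurl2]
    refine Finset.sum_congr rfl fun i _ => ?_
    have h1 : (fun y => fderiv ℝ (curl v) y (b i)) = curl fun z => fderiv ℝ v z (b i) :=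
      funext fun y => (curl_fderiv_apply hv2 y (b i)).symm
    rw [h1, ← curl_fderiv_apply (hd1 (b i)) x (b i)]
  -- left-hand side
  have hL : curl (Δ v) x =
      ∑ i, curl (fun y => fderiv ℝ (fun z => fderiv ℝ v z (b i)) y (b i)) x := by
    have hΔ : Δ v = fun y => ∑ i, fderiv ℝ (fun z => fderiv ℝ v z (b i)) y (b i) :=
      funext fun y => laplacian_eq_sum_fderiv_fderiv b hv2 y
    rw [curl_eq_curlCLM, hΔ,
      fderiv_fun_sum fun i _ => (hd2 (b i) (b i)).differentiable one_ne_zero x, map_sum]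
    rfl
  rw [hL, hR]

/-! ### Pointwise bounds -/

/-- `‖curlCLM (ℓ ⊗ a)‖ ≤ ‖curlCLM‖ ‖ℓ‖ ‖a‖` for the rank-one operator `ℓ.smulRight a`. [folklore] -/
theorem norm_curlCLM_smulRight_le (ℓ : ℝ³ →L[ℝ] ℝ) (a : ℝ³) :
    ‖curlCLM (ℓ.smulRight a)‖ ≤ ‖curlCLM‖ * (‖ℓ‖ * ‖a‖) := by
  refine (curlCLM.le_opNorm _).trans ?_
  gcongr
  exact ContinuousLinearMap.norm_smulRight_apply ℓ a ▸ le_rfl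

/-- `‖curl v (x)‖² ≤ ‖curlCLM‖² |Dv(x)|²` with the Frobenius norm on the right (operator norm
dominated by the Frobenius norm, `Fluid.sq_opNorm_le_frobeniusNormSq`). [folklore] -/
theorem norm_curl_sq_le_frobeniusNormSq (v : ℝ³ → ℝ³) (x : ℝ³) :
    ‖curl v x‖ ^ 2 ≤ ‖curlCLM‖ ^ 2 * frobeniusNormSq (fderiv ℝ v x) := by
  calc ‖curl v x‖ ^ 2 ≤ (‖curlCLM‖ * ‖fderiv ℝ v x‖) ^ 2 :=
        pow_le_pow_left₀ (norm_nonneg _) (norm_curl_le v x) 2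
    _ = ‖curlCLM‖ ^ 2 * ‖fderiv ℝ v x‖ ^ 2 := by ring
    _ ≤ ‖curlCLM‖ ^ 2 * frobeniusNormSq (fderiv ℝ v x) := by
        gcongr; exact sq_opNorm_le_frobeniusNormSq _

end Literature.Analysis.FluidPDE

end
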